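/-
Copyright (c) 2026 the pub-hodgecm-mathlib formalisation cell (harness21).  Prover seat hodgecm-mathlib-LH7-p04 (g8): E3 §2(4) «(IT) PART 3: BLOCK TRANSPORT» dealt by the N8-INNER road
owner LH2-plan (g1) 2026-09-02 (17:05:24Z ∕ 17:05:52Z) for E3a of LH3-p04 (g7) (census E3 v1 4ea0a8286c8e31d7 §2(4), ask (B4)).
-/
import Literature.NumberTheory.Automorphic.ArchInnerTwistPlaceTransportOrb    -- ★ (IT) PART 2 (p852102): `isHaarMeasure_map_innerTwist_restrict`, `map_innerTwist_restrict_chartBoxImgGLoc`; brings PART 1 `innerTwist_mem_chartTorusGLoc_iff`, ★ `cosetCongr`, `map_cosetCongr_quotientMeasure`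
import HarnessLib

/-!
# Identity transport at the complex places, PART 3: the BLOCK form (a finite set of places at once)

Topic `NumberTheory/Automorphic`; namespace `Literature.NumberTheory.Automorphic.UnitaryGroup`.  THEOREMS ONLY (no definition, no instance, no notation, no named fact, no `sorry`);
kernel lane `--supports stmt-HodgeConjecture-24833`.  Cell `pub/hodgecm-mathlib` (D-0151), crux H413; HCML «GO 500» road N8-INNER (owner∕dealer LH2-plan (g1)), line E (the EP assembly
E3 = H-S4′ of LH3-p04 (g7)), item §2(4) of census E3 v1: the `I`-block quotient reading of ★ (F2) `chartOrbG_eq_prod_quotient_mul_integral_of_tensor`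
(`(Π_{w′∈I} t_{w′}(B′_{w′})) · ∫_{Π_I (U_{w′}⧸T′_{w′})} U(… ẏ_{w′} γ_{w′} ẏ_{w′}⁻¹ …) d(⊗_I ν′_{w′}∕t_{w′})`) TRANSPORTS along the place isomorphisms `ι_{w′} : U(α)_{w′} ≃ U(β)_{w′}` of ★ (IT) PART 1
(`exists_continuousMulEquiv_archLocal_innerTwist`; `ι γ^α_{w′}(c) = γ^β_{w′}(c)`): `R^β_I[U] = R^α_I[U ∘ ι_I]`.  Everything is ★ ONE PLACE AT A TIME — ★ (IT) PART 2 (`isHaarMeasure_map_innerTwist_restrict`,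
`map_innerTwist_restrict_chartBoxImgGLoc`) and the generic ★ `Literature/MeasureTheory/Group/InvariantQuotientTransport` (`cosetCongr`, **`map_cosetCongr_quotientMeasure`** — naturality of the
Deitmar–Echterhoff quotient measure); this file is the `Measure.pi` ∕ `MeasurePreserving` packaging (Mathlib `measurePreserving_pi`, `MeasurePreserving.integral_comp`).  HONEST LABEL:
count-neutral plumbing; HC_CM is proved only modulo the 7 printed citations (2 remaining: hLiu418 = stmt-HodgeConjecture-24832, h413 = stmt-HodgeConjecture-24833) until rung 0 closes.

CONVENTIONS (= ★ (F2)'s): the quotient σ-algebras on `U(α)_w ⧸ T′_w` AND `U(β)_w ⧸ T′_w` are SECTION INSTANCES (Borel); the image measures are FREE NAMES with defining hypotheses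
(`ht′ : t′ = (ι|_{T′})⁎ t`, `hν′ : ν′ = ι⁎ ν`, as ★ `map_cosetCongr_quotientMeasure`) and Haar instance binders (discharged by the consumer with ★ (IT) PART 2
`isHaarMeasure_map_innerTwist_restrict` ∕ `isHaarMeasure_map_innerTwist` ∕ `isMulRightInvariant_map_innerTwist` through `haveI`); in §2 the QUOTIENT measures of the block are free names
`q k`, `q′ k` and the one-place conclusion (B-1) is the hypothesis `hmp k : MeasurePreserving ι̅_k (q k) (q′ k)` (the consumer passes `q′ := fun w′ => quotientMeasure …` — so
`Measure.pi q′` IS (F2)'s `Measure.pi fun w′ => quotientMeasure …` — and `hmp k := measurePreserving_cosetCongr_innerTwist …` at its concrete places; no Haar instance search over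
a dependent family happens in this file).  The block is an ARBITRARY finite index type `I` with `v : I → W` (E3a: `I := {w // ¬ p w}`, `v := Subtype.val`, matching (F2)'s `w′.1`).

* §1 (one place) `map_restrictSubgroup_eq_map_subgroupCongrHomeomorph`, **`measurePreserving_cosetCongr_innerTwist`** (B-1), `descConj_id_cosetCongr_innerTwist` (B-3),
  `map_restrict_chartBoxImgGLoc_eq` (box masses).
* §2 (block) **`measurePreserving_pi_cosetCongr_innerTwist`** (B-2), **`integral_pi_quotientMeasure_innerTwist`** (B-4), `prod_box_innerTwist`, **`blockReading_innerTwist`** (B-5: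
  `R^β_I[U] = R^α_I[U ∘ ι_I]`).

## References
* [DeitmarEchterhoff2014] A. Deitmar, S. Echterhoff, *Principles of Harmonic Analysis*, 2nd ed. (2014), Thm. 1.5.3 (canonical invariant measure on `G ⧸ H`; naturality).
* [Folland1995] G. B. Folland, *A Course in Abstract Harmonic Analysis* (1995), §2.6 (2.52) (change of variables along a group isomorphism); §2.2 (product measures).
* [Rogawski1990] J. D. Rogawski, *Automorphic Representations of Unitary Groups in Three Variables*, Ann. of Math. Stud. 123 (1990), §14.2 pp. 232–233, §8.2 p. 122.
-/

set_option autoImplicit false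

noncomputable section

open MeasureTheory MeasureTheory.Measure NumberField NumberField.InfinitePlace Matrix Complex Topology
open Literature.MeasureTheory.Group
open scoped MatrixGroups Matrix ENNReal NNReal

namespace Literature.NumberTheory.Automorphic.UnitaryGroup

/-! ## §1 One place -/

section One

variable (L : Type) [Field L] [NumberField L] [IsCMField L] (α β : Fin 3 → L) (w : {w : InfinitePlace L // IsComplex w}) (S' : Finset {w : InfinitePlace L // IsComplex w})
  [MeasurableSpace ↥(archLocal L 3 (Matrix.diagonal α) w)] [BorelSpace ↥(archLocal L 3 (Matrix.diagonal α) w)]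
  [MeasurableSpace ↥(archLocal L 3 (Matrix.diagonal β) w)] [BorelSpace ↥(archLocal L 3 (Matrix.diagonal β) w)]
  (ι : ↥(archLocal L 3 (Matrix.diagonal α) w) ≃ₜ* ↥(archLocal L 3 (Matrix.diagonal β) w))
  (hι : ∀ (S' : Finset {w : InfinitePlace L // IsComplex w}) (cw : Fin 3 → ℝ), ι (gprimeBlockAt L α w S' cw) = gprimeBlockAt L β w S' cw)

omit [BorelSpace ↥(archLocal L 3 (Matrix.diagonal α) w)] [BorelSpace ↥(archLocal L 3 (Matrix.diagonal β) w)] in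
/-- The image of a torus measure under `ι|_{T′}` in the two ★ spellings (`ContinuousMulEquiv.restrictSubgroup` of ★ (IT) PART 2, `subgroupCongrHomeomorph` of ★ `InvariantQuotientTransport`) is the same
measure (same underlying map). [cite: Folland1995, §2.6 (2.52)] -/
theorem map_restrictSubgroup_eq_map_subgroupCongrHomeomorph (t : Measure ↥(chartTorusGLoc L α w S')) :
    t.map (ContinuousMulEquiv.restrictSubgroup ι (chartTorusGLoc L α w S') (chartTorusGLoc L β w S') (fun g => (innerTwist_mem_chartTorusGLoc_iff L α β w ι hι S' g).symm)) =
      t.map (subgroupCongrHomeomorph ι.toMulEquiv (chartTorusGLoc L α w S') (chartTorusGLoc L β w S') (fun g => innerTwist_mem_chartTorusGLoc_iff L α β w ι hι S' g)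
        ι.continuous ι.symm.continuous) := by
  congr 1

/-- **Equal box masses** in the free-name convention: `t′(B′_β) = t(B′_α)` for `t′ = (ι|_{T′})⁎ t` (★ (IT) PART 2 `map_innerTwist_restrict_chartBoxImgGLoc`). [cite: Rogawski1990, §8.2 p. 122] -/
theorem map_restrict_chartBoxImgGLoc_eq (t : Measure ↥(chartTorusGLoc L α w S')) (t' : Measure ↥(chartTorusGLoc L β w S'))
    (ht' : t' = t.map (ContinuousMulEquiv.restrictSubgroup ι (chartTorusGLoc L α w S') (chartTorusGLoc L β w S') (fun g => (innerTwist_mem_chartTorusGLoc_iff L α β w ι hι S' g).symm))) :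
    t' (chartBoxImgGLoc L β w S') = t (chartBoxImgGLoc L α w S') := by
  rw [ht']
  exact map_innerTwist_restrict_chartBoxImgGLoc L α β w ι S' hι t

omit [MeasurableSpace ↥(archLocal L 3 (Matrix.diagonal α) w)] [BorelSpace ↥(archLocal L 3 (Matrix.diagonal α) w)]
  [MeasurableSpace ↥(archLocal L 3 (Matrix.diagonal β) w)] [BorelSpace ↥(archLocal L 3 (Matrix.diagonal β) w)] in
/-- **(B-3) THE ORBITAL POINT TRANSPORTS**: `(ι̅ ẏ) γ^β (ι̅ ẏ)⁻¹ = ι (ẏ γ^α ẏ⁻¹)` — the identity-valued orbital integrand ★ `descConj … id` of (F2) under ★ `cosetCongr` (`ι γ^α = γ^β`).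
[cite: Folland1995, §2.6 (2.52)] -/
theorem descConj_id_cosetCongr_innerTwist (cw : Fin 3 → ℝ) (y : ↥(archLocal L 3 (Matrix.diagonal α) w) ⧸ chartTorusGLoc L α w S') :
    descConj (gprimeBlockAt L β w S' cw) (chartTorusGLoc L β w S') (forall_mem_chartTorusGLoc_comm L β w S' cw) id
        (cosetCongr ι.toMulEquiv (chartTorusGLoc L α w S') (chartTorusGLoc L β w S') (fun g => innerTwist_mem_chartTorusGLoc_iff L α β w ι hι S' g) y) =
      ι (descConj (gprimeBlockAt L α w S' cw) (chartTorusGLoc L α w S') (forall_mem_chartTorusGLoc_comm L α w S' cw) id y) := by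
  induction y using QuotientGroup.induction_on with
  | H g =>
    rw [cosetCongr_mk, descConj_mk, descConj_mk]
    show ι g * gprimeBlockAt L β w S' cw * (ι g)⁻¹ = ι (g * gprimeBlockAt L α w S' cw * g⁻¹)
    rw [map_mul, map_mul, map_inv, hι]

variable
  [LocallyCompactSpace ↥(archLocal L 3 (Matrix.diagonal α) w)] [SecondCountableTopology ↥(archLocal L 3 (Matrix.diagonal α) w)]
  [LocallyCompactSpace ↥(archLocal L 3 (Matrix.diagonal β) w)] [SecondCountableTopology ↥(archLocal L 3 (Matrix.diagonal β) w)]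
  [MeasurableSpace (↥(archLocal L 3 (Matrix.diagonal α) w) ⧸ chartTorusGLoc L α w S')] [BorelSpace (↥(archLocal L 3 (Matrix.diagonal α) w) ⧸ chartTorusGLoc L α w S')]
  [MeasurableSpace (↥(archLocal L 3 (Matrix.diagonal β) w) ⧸ chartTorusGLoc L β w S')] [BorelSpace (↥(archLocal L 3 (Matrix.diagonal β) w) ⧸ chartTorusGLoc L β w S')]

/-- **(B-1) THE QUOTIENT-LEVEL PLACE ISOMORPHISM `ι̅_w : U(α)_w ⧸ T′ → U(β)_w ⧸ T′` PRESERVES THE QUOTIENT MEASURES**: with `t′ = (ι|_{T′})⁎ t` and `ν′ = ι⁎ ν`,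
`ι̅⁎ (ν ∕ t) = ν′ ∕ t′` (★ `map_cosetCongr_quotientMeasure`) and `ι̅ =` ★ `cosetCongr` is continuous ((F2)'s section instances: Borel quotient σ-algebras, locally compact second countable
place groups). [cite: DeitmarEchterhoff2014, Thm. 1.5.3] [cite: Folland1995, §2.6 (2.52)] -/
theorem measurePreserving_cosetCongr_innerTwist
    (t : Measure ↥(chartTorusGLoc L α w S')) [t.IsHaarMeasure] [t.IsInvInvariant]
    (t' : Measure ↥(chartTorusGLoc L β w S')) [t'.IsHaarMeasure] [t'.IsInvInvariant]
    (ht' : t' = t.map (ContinuousMulEquiv.restrictSubgroup ι (chartTorusGLoc L α w S') (chartTorusGLoc L β w S') (fun g => (innerTwist_mem_chartTorusGLoc_iff L α β w ι hι S' g).symm)))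
    (ν : Measure ↥(archLocal L 3 (Matrix.diagonal α) w)) [ν.IsHaarMeasure] [ν.IsMulRightInvariant]
    (ν' : Measure ↥(archLocal L 3 (Matrix.diagonal β) w)) [ν'.IsHaarMeasure] [ν'.IsMulRightInvariant] (hν' : ν' = ν.map ι) :
    MeasurePreserving (cosetCongr ι.toMulEquiv (chartTorusGLoc L α w S') (chartTorusGLoc L β w S') (fun g => innerTwist_mem_chartTorusGLoc_iff L α β w ι hι S' g))
      (quotientMeasure (chartTorusGLoc L α w S') t (isClosed_chartTorusGLoc L α w S') ν)
      (quotientMeasure (chartTorusGLoc L β w S') t' (isClosed_chartTorusGLoc L β w S') ν') := by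
  haveI := locallyCompactSpace_chartTorusGLoc L α w S'
  haveI := locallyCompactSpace_chartTorusGLoc L β w S'
  refine ⟨(continuous_cosetCongr ι.toMulEquiv (chartTorusGLoc L α w S') (chartTorusGLoc L β w S') _ ι.continuous).measurable, ?_⟩
  exact map_cosetCongr_quotientMeasure ι.toMulEquiv ι.continuous ι.symm.continuous (chartTorusGLoc L α w S') (chartTorusGLoc L β w S') _
    (hH := isClosed_chartTorusGLoc L α w S') (hH' := isClosed_chartTorusGLoc L β w S') t t' ν ν'
    (by rw [ht', map_restrictSubgroup_eq_map_subgroupCongrHomeomorph L α β w S' ι hι]) hν'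

end One

/-! ## §2 A finite block of places -/

section Block

variable (L : Type) [Field L] [NumberField L] [IsCMField L] (α β : Fin 3 → L) (S' : Finset {w : InfinitePlace L // IsComplex w})
  [∀ w : {w : InfinitePlace L // IsComplex w}, MeasurableSpace ↥(archLocal L 3 (Matrix.diagonal α) w)] [∀ w : {w : InfinitePlace L // IsComplex w}, BorelSpace ↥(archLocal L 3 (Matrix.diagonal α) w)]
  [∀ w : {w : InfinitePlace L // IsComplex w}, MeasurableSpace ↥(archLocal L 3 (Matrix.diagonal β) w)] [∀ w : {w : InfinitePlace L // IsComplex w}, BorelSpace ↥(archLocal L 3 (Matrix.diagonal β) w)]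
  {I : Type} [Fintype I] (v : I → {w : InfinitePlace L // IsComplex w})
  (ι : ∀ k : I, ↥(archLocal L 3 (Matrix.diagonal α) (v k)) ≃ₜ* ↥(archLocal L 3 (Matrix.diagonal β) (v k)))
  (hι : ∀ (k : I) (S' : Finset {w : InfinitePlace L // IsComplex w}) (cw : Fin 3 → ℝ), ι k (gprimeBlockAt L α (v k) S' cw) = gprimeBlockAt L β (v k) S' cw)
  (t : ∀ k : I, Measure ↥(chartTorusGLoc L α (v k) S')) (t' : ∀ k : I, Measure ↥(chartTorusGLoc L β (v k) S'))
  (ht' : ∀ k, t' k = (t k).map (ContinuousMulEquiv.restrictSubgroup (ι k) (chartTorusGLoc L α (v k) S') (chartTorusGLoc L β (v k) S')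
    (fun g => (innerTwist_mem_chartTorusGLoc_iff L α β (v k) (ι k) (hι k) S' g).symm)))

include hι ht' in
/-- **Equal box constants over the block**: `Π_k t′_k(B′_β) = Π_k t_k(B′_α)`. [cite: Rogawski1990, §8.2 p. 122] -/
theorem prod_box_innerTwist :
    (∏ k, (((t' k) (chartBoxImgGLoc L β (v k) S')).toReal : ℂ)) = ∏ k, (((t k) (chartBoxImgGLoc L α (v k) S')).toReal : ℂ) :=
  Finset.prod_congr rfl fun k _ => by rw [map_restrict_chartBoxImgGLoc_eq L α β (v k) S' (ι k) (hι k) (t k) (t' k) (ht' k)]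

/- The block's quotient measures enter as FREE NAMES `q k`, `q′ k` on the (F2)-instance quotients, with the ONE-PLACE conclusion (B-1) as the hypothesis `hmp` (the consumer passes
`q := fun k => quotientMeasure …`, `q′ := …` and `hmp k := measurePreserving_cosetCongr_innerTwist …` at its concrete places; no Haar instance search happens inside this file). -/
variable
  [∀ w : {w : InfinitePlace L // IsComplex w}, MeasurableSpace (↥(archLocal L 3 (Matrix.diagonal α) w) ⧸ chartTorusGLoc L α w S')]
  [∀ w : {w : InfinitePlace L // IsComplex w}, BorelSpace (↥(archLocal L 3 (Matrix.diagonal α) w) ⧸ chartTorusGLoc L α w S')]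
  [∀ w : {w : InfinitePlace L // IsComplex w}, MeasurableSpace (↥(archLocal L 3 (Matrix.diagonal β) w) ⧸ chartTorusGLoc L β w S')]
  [∀ w : {w : InfinitePlace L // IsComplex w}, BorelSpace (↥(archLocal L 3 (Matrix.diagonal β) w) ⧸ chartTorusGLoc L β w S')]
  (q : ∀ k : I, Measure (↥(archLocal L 3 (Matrix.diagonal α) (v k)) ⧸ chartTorusGLoc L α (v k) S'))
  (q' : ∀ k : I, Measure (↥(archLocal L 3 (Matrix.diagonal β) (v k)) ⧸ chartTorusGLoc L β (v k) S')) [∀ k, SigmaFinite (q' k)]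
  (hmp : ∀ k, MeasurePreserving
    (cosetCongr (ι k).toMulEquiv (chartTorusGLoc L α (v k) S') (chartTorusGLoc L β (v k) S') (fun g => innerTwist_mem_chartTorusGLoc_iff L α β (v k) (ι k) (hι k) S' g))
    (q k) (q' k))

omit [∀ w : {w : InfinitePlace L // IsComplex w}, MeasurableSpace ↥(archLocal L 3 (Matrix.diagonal α) w)] [∀ w : {w : InfinitePlace L // IsComplex w}, BorelSpace ↥(archLocal L 3 (Matrix.diagonal α) w)]
  [∀ w : {w : InfinitePlace L // IsComplex w}, MeasurableSpace ↥(archLocal L 3 (Matrix.diagonal β) w)] [∀ w : {w : InfinitePlace L // IsComplex w}, BorelSpace ↥(archLocal L 3 (Matrix.diagonal β) w)]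
  [∀ w : {w : InfinitePlace L // IsComplex w}, BorelSpace (↥(archLocal L 3 (Matrix.diagonal α) w) ⧸ chartTorusGLoc L α w S')]
  [∀ w : {w : InfinitePlace L // IsComplex w}, BorelSpace (↥(archLocal L 3 (Matrix.diagonal β) w) ⧸ chartTorusGLoc L β w S')] in
include hmp in
/-- **(B-2) THE BLOCK OF QUOTIENT-LEVEL PLACE ISOMORPHISMS PRESERVES THE PRODUCT QUOTIENT MEASURES**: `(ι̅_k)_k : Π_k (U(α)_{v k} ⧸ T′) → Π_k (U(β)_{v k} ⧸ T′)` pushes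
`⊗_k q_k` to `⊗_k q′_k` as soon as each `ι̅_k` pushes `q_k` to `q′_k` ((B-1) `measurePreserving_cosetCongr_innerTwist`; Mathlib `measurePreserving_pi`).
[cite: DeitmarEchterhoff2014, Thm. 1.5.3] [cite: Folland1995, §2.2; §2.6 (2.52)] -/
theorem measurePreserving_pi_cosetCongr_innerTwist :
    MeasurePreserving
      (fun (b : ∀ k : I, ↥(archLocal L 3 (Matrix.diagonal α) (v k)) ⧸ chartTorusGLoc L α (v k) S') (k : I) =>
        cosetCongr (ι k).toMulEquiv (chartTorusGLoc L α (v k) S') (chartTorusGLoc L β (v k) S') (fun g => innerTwist_mem_chartTorusGLoc_iff L α β (v k) (ι k) (hι k) S' g) (b k))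
      (Measure.pi q) (Measure.pi q') :=
  measurePreserving_pi q q' hmp

omit [∀ w : {w : InfinitePlace L // IsComplex w}, MeasurableSpace ↥(archLocal L 3 (Matrix.diagonal α) w)] [∀ w : {w : InfinitePlace L // IsComplex w}, BorelSpace ↥(archLocal L 3 (Matrix.diagonal α) w)]
  [∀ w : {w : InfinitePlace L // IsComplex w}, MeasurableSpace ↥(archLocal L 3 (Matrix.diagonal β) w)] [∀ w : {w : InfinitePlace L // IsComplex w}, BorelSpace ↥(archLocal L 3 (Matrix.diagonal β) w)] in
include hmp in
/-- **(B-4) THE `I`-BLOCK QUOTIENT INTEGRAL TRANSPORTS**: for EVERY `U : (Π_k U(β)_{v k}) → E` (no measurability asked — change of variables along a measurable equivalence),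
`∫_{Π_k (U(β)⧸T′)} U((ẏ′_k γ^β_k ẏ′_k⁻¹)_k) d⊗q′ = ∫_{Π_k (U(α)⧸T′)} U((ι_k(ẏ_k γ^α_k ẏ_k⁻¹))_k) d⊗q`, in the `descConj … id` currency of ★ (F2).
[cite: Folland1995, §2.6 (2.52)] [cite: DeitmarEchterhoff2014, Thm. 1.5.3] [cite: Rogawski1990, §8.2 p. 122] -/
theorem integral_pi_quotientMeasure_innerTwist {E : Type*} [NormedAddCommGroup E] [NormedSpace ℝ E] (c : I → Fin 3 → ℝ)
    (U : (∀ k : I, ↥(archLocal L 3 (Matrix.diagonal β) (v k))) → E) :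
    ∫ b', U (fun k => descConj (gprimeBlockAt L β (v k) S' (c k)) (chartTorusGLoc L β (v k) S') (forall_mem_chartTorusGLoc_comm L β (v k) S' (c k)) id (b' k)) ∂(Measure.pi q') =
      ∫ b, U (fun k => ι k (descConj (gprimeBlockAt L α (v k) S' (c k)) (chartTorusGLoc L α (v k) S') (forall_mem_chartTorusGLoc_comm L α (v k) S' (c k)) id (b k)))
        ∂(Measure.pi q) := by
  -- the block map is a measurable embedding (a product of homeomorphisms)
  have hemb : MeasurableEmbedding
      (fun (b : ∀ k : I, ↥(archLocal L 3 (Matrix.diagonal α) (v k)) ⧸ chartTorusGLoc L α (v k) S') (k : I) =>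
        cosetCongr (ι k).toMulEquiv (chartTorusGLoc L α (v k) S') (chartTorusGLoc L β (v k) S') (fun g => innerTwist_mem_chartTorusGLoc_iff L α β (v k) (ι k) (hι k) S' g) (b k)) :=
    (MeasurableEquiv.piCongrRight fun k =>
      (cosetCongrHomeomorph (ι k).toMulEquiv (chartTorusGLoc L α (v k) S') (chartTorusGLoc L β (v k) S')
        (fun g => innerTwist_mem_chartTorusGLoc_iff L α β (v k) (ι k) (hι k) S' g) (ι k).continuous (ι k).symm.continuous).toMeasurableEquiv).measurableEmbedding
  rw [← (measurePreserving_pi_cosetCongr_innerTwist L α β S' v ι hι q q' hmp).integral_comp hemb]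
  refine integral_congr_ae (Filter.Eventually.of_forall fun b => ?_)
  exact congrArg U (funext fun k => descConj_id_cosetCongr_innerTwist L α β (v k) S' (ι k) (hι k) (c k) (b k))

include hmp ht' in
/-- **(B-5) THE `I`-BLOCK READING TRANSPORTS: `R^β_I[U] = R^α_I[U ∘ ι_I]`** — box constants times the product quotient integral of ★ (F2)'s `¬p`-side, at the `β`-frame with the image
measures, equals the same reading at the `α`-frame of `U ∘ ι_I` (E3 §2(4): `U := u_c` on the `I`-block, `U ∘ ι_I = Ã_J(cl_D c, ·)`). [cite: Rogawski1990, §8.2 p. 122; §14.2 p. 233]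
[cite: Folland1995, §2.6 (2.52)] [cite: DeitmarEchterhoff2014, Thm. 1.5.3] -/
theorem blockReading_innerTwist (c : I → Fin 3 → ℝ) (U : (∀ k : I, ↥(archLocal L 3 (Matrix.diagonal β) (v k))) → ℂ) :
    (∏ k, (((t' k) (chartBoxImgGLoc L β (v k) S')).toReal : ℂ)) *
        ∫ b', U (fun k => descConj (gprimeBlockAt L β (v k) S' (c k)) (chartTorusGLoc L β (v k) S') (forall_mem_chartTorusGLoc_comm L β (v k) S' (c k)) id (b' k)) ∂(Measure.pi q') =
      (∏ k, (((t k) (chartBoxImgGLoc L α (v k) S')).toReal : ℂ)) *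
        ∫ b, U (fun k => ι k (descConj (gprimeBlockAt L α (v k) S' (c k)) (chartTorusGLoc L α (v k) S') (forall_mem_chartTorusGLoc_comm L α (v k) S' (c k)) id (b k)))
          ∂(Measure.pi q) := by
  rw [prod_box_innerTwist L α β S' v ι hι t t' ht', integral_pi_quotientMeasure_innerTwist L α β S' v ι hι q q' hmp c U]

end Block

end Literature.NumberTheory.Automorphic.UnitaryGroup
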